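import Summits.ResolutionOfSingularities.ResolutionOfSingularities.Theorems.EquisingularLiftEquisingularLiftNatVertexLineDefs
import Literature.AlgebraicGeometry.Resolution.PointBlowupFibreRings
import Literature.AlgebraicGeometry.Motives.ProjBasicOpenSubscheme
import HarnessLib

/-!
# [OURS · L1 W4.5(b) · EL♮(3) · nose residue, D3-9 file 2/4] The strict transform of the vertex line on the VERTEX CHART
# `Spec k[X][I/X_{i₀}]`: its ideal `(X_j/X_{i₀} : j ≠ i₀)` (prime, misses `X_{i₀}`) and its points

Crux chain w45b, child EL♮(3) = stmt-ResolutionOfSingularities-20148; desk table D3, row **D3-9** «Steiner LINE instances of `DirStepUnobs`»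
(res-L1-w45b-nose-w3 g2). `--supports stmt-ResolutionOfSingularities-20148 --as helper`. OURS; NOT a statement of any manuscript; AI-written,
weaker than expert review. No `sorry`; standard axioms; DEF-FREE (the de Jong vertex kit's `attribute [local instance] MvPolynomial.gradedAlgebra`
is needed to write `Proj k[x]`).

Setting (tree's de Jong Lemma 4.11 vertex kit, `Literature/…/VertexBlowupCharts`, `PointBlowupAlgebraCharts`): ANY blowing up
`b : P̃ ⟶ ℙ^{d+1}_k` of the vertex `p = (0:…:0:1)`, the vertex chart `c = vertexChart hb i₀ : Spec Cᵢ₀ ⟶ P̃`,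
`Cᵢ₀ = k[X₀,…,X_d][I/X_{i₀}] ≅ k[X_j/X_{i₀} : j ≠ i₀][X_{i₀}]` (`PointBlowup.polyEquiv`), and the line `vertexLine d k i₀ = V₊(x_j : j ≤ d, j ≠ i₀)`
with strict transform `vertexLineStrict b i₀` (✓ `…NatVertexLineDefs`). PROVED:

* ALGEBRA in `Cᵢ₀`: `ker_constantCoeff_eq_span_X`; `ker_lineQuotHom` — the ideal `𝔮 = (X_j/X_{i₀} : j ≠ i₀)` is the kernel of
  `Cᵢ₀ ≅ k[Y][T] → k[T]` (`Y ↦ 0`), hence PRIME (`isPrime_span_frac`) and `X_{i₀} ∉ 𝔮` (`exc_notMem_span_frac`); the points of `Spec Cᵢ₀`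
  over the punctured line are `V(𝔮) ∩ D(X_{i₀})` (`forall_algebraMap_X_mem_iff`) whose closure is `V(𝔮)` (`closure_zeroLocus_inter_eq`).
* POINTS: `vertexChart_apply_mem_iff` — `c 𝔭 ∈ b⁻¹(vertexLine ∖ {vertex}) ↔ 𝔮 ≤ 𝔭 ∧ X_{i₀} ∉ 𝔭` (through `vertexChart_comp`,
  `fromSpec_affineBasicOpen`, `X_castSucc_mem_awayι_iff`, `eq_vertex_iff`); ★ `preimage_vertexChart_vertexLineStrict` — **the strict transform
  meets the vertex chart in `V(X_j/X_{i₀} : j ≠ i₀)`**: `c⁻¹(vertexLineStrict b i₀) = zeroLocus 𝔮`; and `preimage_vertexChart_vertexLineStrict_of_ne`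
  — it MISSES the other vertex charts (`i ≠ i₀`).

Next files: the sections/vanishing-ideal form on both charts (`…ChartB`) and the `DirStepUnobs` certificate (`…Unobs`, via ✓ p654480/p654968).
References (index only): A. J. de Jong (1996), proof of Lemma 4.11 [cite: DeJong1996]; The Stacks Project, Tag 0804 [cite: StacksProject];
R. Hartshorne (1977), II §7 [cite: Hartshorne1977].
-/

set_option linter.dupNamespace false -- mandated namespace `Summit.<Summit>.<Problem>` of this single-conjunct summit

noncomputable section

open CategoryTheory AlgebraicGeometry TopologicalSpace HomogeneousLocalization Topology
open Literature.AlgebraicGeometry.Resolution Literature.AlgebraicGeometry.Resolution.DeJong1996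
open Literature.AlgebraicGeometry.Resolution.PointBlowup (Chart Base frac exc polyEquiv polyHom baseHom originIdeal)
open Literature.AlgebraicGeometry.Motives.Segre (grading X_mem)

attribute [local instance] MvPolynomial.gradedAlgebra

namespace Summit.ResolutionOfSingularities.ResolutionOfSingularities.Cruxes.EquisingularLiftNat.Sections

/-! ## Algebra in the chart ring `Cᵢ₀ = k[X][I/X_{i₀}]` -/

section Algebra

variable {d : ℕ} {k : Type} [Field k] (i₀ : Fin (d + 1))

/-- The kernel of the constant coefficient `k[Y] → k` is the ideal of all the variables. [folklore] -/
theorem ker_constantCoeff_eq_span_X (σ : Type) :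
    RingHom.ker (MvPolynomial.constantCoeff : MvPolynomial σ k →+* k) = Ideal.span (Set.range MvPolynomial.X) := by
  ext f
  rw [RingHom.mem_ker, ← Set.image_univ, MvPolynomial.mem_ideal_span_X_image, MvPolynomial.constantCoeff_eq]
  constructor
  · intro h m hm
    by_contra hcon
    push Not at hcon
    have hm0 : m = 0 := Finsupp.ext fun i => by simpa using hcon i (Set.mem_univ i)
    rw [hm0, MvPolynomial.mem_support_iff] at hm
    exact hm h
  · intro h
    by_contra hne
    obtain ⟨i, -, hi⟩ := h 0 (MvPolynomial.mem_support_iff.mpr hne)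
    exact hi rfl

/-- `polyEquiv⁻¹ (X_j/X_{i₀}) = C (Y_j)` for `j ≠ i₀`. [folklore] -/
theorem polyEquiv_symm_frac {j : Fin (d + 1)} (hj : j ≠ i₀) :
    (polyEquiv d k i₀).symm (frac d k i₀ j) = MvPolynomial.C (MvPolynomial.X ⟨j, hj⟩) := by
  rw [← PointBlowup.baseHom_X d k i₀ ⟨j, hj⟩, PointBlowup.polyEquiv_symm_baseHom]

/-- `polyEquiv⁻¹ (X_{i₀}) = T`. [folklore] -/
theorem polyEquiv_symm_exc : (polyEquiv d k i₀).symm (exc d k i₀) = MvPolynomial.X () := by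
  apply (polyEquiv d k i₀).injective
  rw [RingEquiv.apply_symm_apply, PointBlowup.polyEquiv_apply, PointBlowup.polyHom_X]

/-- **The ideal `(X_j/X_{i₀} : j ≠ i₀)` of the chart ring is the kernel of `Cᵢ₀ ≅ k[Y][T] → k[T]`, `Y ↦ 0`.** [folklore] -/
theorem ker_lineQuotHom :
    RingHom.ker ((MvPolynomial.map (σ := Unit) (MvPolynomial.constantCoeff : Base d k i₀ →+* k)).comp
      (polyEquiv d k i₀).symm.toRingHom) = Ideal.span (frac d k i₀ '' {i₀}ᶜ) := by
  rw [← RingHom.comap_ker, MvPolynomial.ker_map, ker_constantCoeff_eq_span_X, Ideal.map_span, RingEquiv.toRingHom_eq_coe,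
    Ideal.comap_coe, Ideal.comap_symm, Ideal.map_span]
  congr 1
  ext a
  simp only [Set.mem_image, Set.mem_range, Set.mem_compl_iff, Set.mem_singleton_iff, exists_exists_eq_and]
  constructor
  · rintro ⟨⟨j, hj⟩, rfl⟩
    refine ⟨j, hj, ?_⟩
    rw [← polyEquiv_symm_frac i₀ hj, RingEquiv.apply_symm_apply]
  · rintro ⟨j, hj, rfl⟩
    refine ⟨⟨j, hj⟩, ?_⟩
    rw [← polyEquiv_symm_frac i₀ hj, RingEquiv.apply_symm_apply]

/-- **The ideal `(X_j/X_{i₀} : j ≠ i₀)` is prime** (its quotient is `k[T]`). [folklore] -/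
theorem isPrime_span_frac : (Ideal.span (frac d k i₀ '' {i₀}ᶜ)).IsPrime := by
  rw [← ker_lineQuotHom]
  exact RingHom.ker_isPrime _

/-- `X_{i₀}` is not in `(X_j/X_{i₀} : j ≠ i₀)` (it maps to `T ≠ 0` in `k[T]`). [folklore] -/
theorem exc_notMem_span_frac : exc d k i₀ ∉ Ideal.span (frac d k i₀ '' {i₀}ᶜ) := by
  rw [← ker_lineQuotHom, RingHom.mem_ker, RingHom.comp_apply, RingEquiv.toRingHom_eq_coe, RingEquiv.coe_toRingHom,
    polyEquiv_symm_exc, MvPolynomial.map_X]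
  exact MvPolynomial.X_ne_zero ()

/-- On the open `D(X_{i₀})`: `X_j ∈ 𝔭 ↔ X_j/X_{i₀} ∈ 𝔭` (`X_j = X_{i₀} · X_j/X_{i₀}`). [folklore] -/
theorem algebraMap_X_mem_iff {𝔭 : Ideal (Chart d k i₀)} [𝔭.IsPrime] (hexc : exc d k i₀ ∉ 𝔭) (j : Fin (d + 1)) :
    algebraMap (MvPolynomial (Fin (d + 1)) k) (Chart d k i₀) (MvPolynomial.X j) ∈ 𝔭 ↔ frac d k i₀ j ∈ 𝔭 := by
  rw [PointBlowup.algebraMap_X]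
  exact ⟨fun h => ((Ideal.IsPrime.mem_or_mem ‹_› h).resolve_left hexc), fun h => Ideal.mul_mem_left _ _ h⟩

/-- **The points of `Spec Cᵢ₀` over the punctured line**: «all `X_j`, `j ≠ i₀`, vanish but not all `X_j`» iff
«`(X_j/X_{i₀} : j ≠ i₀) ≤ 𝔭` and `X_{i₀} ∉ 𝔭`». [folklore] -/
theorem forall_algebraMap_X_mem_iff (𝔭 : Ideal (Chart d k i₀)) [𝔭.IsPrime] :
    ((∀ j : Fin (d + 1), j ≠ i₀ → algebraMap (MvPolynomial (Fin (d + 1)) k) (Chart d k i₀) (MvPolynomial.X j) ∈ 𝔭) ∧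
      ¬ ∀ j : Fin (d + 1), algebraMap (MvPolynomial (Fin (d + 1)) k) (Chart d k i₀) (MvPolynomial.X j) ∈ 𝔭) ↔
    Ideal.span (frac d k i₀ '' {i₀}ᶜ) ≤ 𝔭 ∧ exc d k i₀ ∉ 𝔭 := by
  constructor
  · rintro ⟨hall, hnot⟩
    have hexc : exc d k i₀ ∉ 𝔭 := by
      intro h
      apply hnot
      intro j
      by_cases hj : j = i₀
      · subst hj; exact h
      · exact hall j hj
    refine ⟨?_, hexc⟩
    rw [Ideal.span_le]
    rintro _ ⟨j, hj, rfl⟩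
    exact (algebraMap_X_mem_iff i₀ hexc j).mp (hall j hj)
  · rintro ⟨hle, hexc⟩
    refine ⟨fun j hj => (algebraMap_X_mem_iff i₀ hexc j).mpr (hle (Ideal.subset_span ⟨j, hj, rfl⟩)), fun hall => hexc ?_⟩
    exact hall i₀

/-- **`closure (V(𝔮) ∩ D(X_{i₀})) = V(𝔮)`** for the prime `𝔮 = (X_j/X_{i₀} : j ≠ i₀) ∌ X_{i₀}` (the generic point `𝔮` lies in the set).
[folklore] -/
theorem closure_zeroLocus_inter_eq :
    closure {𝔭 : PrimeSpectrum (Chart d k i₀) | Ideal.span (frac d k i₀ '' {i₀}ᶜ) ≤ 𝔭.asIdeal ∧ exc d k i₀ ∉ 𝔭.asIdeal} =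
      PrimeSpectrum.zeroLocus (Ideal.span (frac d k i₀ '' {i₀}ᶜ) : Set (Chart d k i₀)) := by
  apply le_antisymm
  · refine closure_minimal (fun 𝔭 h𝔭 => ?_) (PrimeSpectrum.isClosed_zeroLocus _)
    exact h𝔭.1
  · let q : PrimeSpectrum (Chart d k i₀) := ⟨Ideal.span (frac d k i₀ '' {i₀}ᶜ), isPrime_span_frac i₀⟩
    have hq : q ∈ {𝔭 : PrimeSpectrum (Chart d k i₀) | Ideal.span (frac d k i₀ '' {i₀}ᶜ) ≤ 𝔭.asIdeal ∧ exc d k i₀ ∉ 𝔭.asIdeal} :=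
      ⟨le_rfl, exc_notMem_span_frac i₀⟩
    calc PrimeSpectrum.zeroLocus (Ideal.span (frac d k i₀ '' {i₀}ᶜ) : Set (Chart d k i₀))
        = closure {q} := (PrimeSpectrum.closure_singleton q).symm
      _ ≤ _ := closure_mono (Set.singleton_subset_iff.mpr hq)

end Algebra

/-! ## The points of the vertex chart over the line -/

section Points

variable {d : ℕ} {k : Type} [Field k] {P : Scheme.{0}} {b : P ⟶ Proj (grading (Fin (d + 1 + 1)) k)}
  (hb : IsBlowup b (vertexIdealSheaf d k)) (i₀ : Fin (d + 1))

/-- Where the vertex chart sends a point: `b (c 𝔭) = awayι 𝔭′` with `𝔭′` the contraction of `𝔭` along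
`(k[x]_{(x_{d+1})})₀ → Γ(D₊(x_{d+1})) → Cᵢ`. [cite: StacksProject, Tag 0804] (bookkeeping) -/
theorem vertexChart_comp_apply (i : Fin (d + 1)) (𝔭 : Spec (.of (Chart d k i))) :
    b (vertexChart hb i 𝔭) =
      Proj.awayι (grading (Fin (d + 1 + 1)) k) (MvPolynomial.X (Fin.last (d + 1))) (X_mem k (Fin.last (d + 1))) zero_lt_one
        (Spec.map (Proj.awayToSection (grading (Fin (d + 1 + 1)) k) (MvPolynomial.X (Fin.last (d + 1))))
          (Spec.map (CommRingCat.ofHom (toChart d k i)) 𝔭)) := by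
  rw [← Scheme.Hom.comp_apply, vertexChart_comp hb i, Scheme.Hom.comp_apply]
  change (lastChart d k).2.fromSpec _ = _
  rw [Literature.AlgebraicGeometry.Motives.ProjSubscheme.fromSpec_affineBasicOpen, Scheme.Hom.comp_apply]

/-- The contracted prime: `chartGen j ∈ 𝔭′ ↔ X_j ∈ 𝔭` (as `X_{i}·(X_j/X_i)` in `Cᵢ`). [folklore] -/
theorem chartGen_mem_iff (i : Fin (d + 1)) (𝔭 : Spec (.of (Chart d k i))) (j : Fin (d + 1)) :
    Literature.AlgebraicGeometry.Motives.ProjectiveSpace.chartGen k (Fin.last (d + 1)) j ∈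
        (Spec.map (Proj.awayToSection (grading (Fin (d + 1 + 1)) k) (MvPolynomial.X (Fin.last (d + 1))))
          (Spec.map (CommRingCat.ofHom (toChart d k i)) 𝔭)).asIdeal ↔
      algebraMap (MvPolynomial (Fin (d + 1)) k) (Chart d k i) (MvPolynomial.X j) ∈ 𝔭.asIdeal := by
  change toChart d k i ((Proj.awayToSection (grading (Fin (d + 1 + 1)) k) (MvPolynomial.X (Fin.last (d + 1)))).hom
    (Literature.AlgebraicGeometry.Motives.ProjectiveSpace.chartGen k (Fin.last (d + 1)) j)) ∈ 𝔭.asIdeal ↔ _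
  rw [← vertexSection_eq, toChart_vertexSection, PointBlowup.algebraMap_X]

/-- **The points of the vertex chart over the punctured line**: `c 𝔭 ∈ b⁻¹(vertexLine ∖ {vertex})` iff
`(X_j/X_{i₀} : j ≠ i₀) ≤ 𝔭` and `X_{i₀} ∉ 𝔭`. [folklore] -/
theorem vertexChart_apply_mem_iff (𝔭 : Spec (.of (Chart d k i₀))) :
    vertexChart hb i₀ 𝔭 ∈ b ⁻¹' (vertexLine d k i₀ \ {vertex d k}) ↔
      Ideal.span (frac d k i₀ '' {i₀}ᶜ) ≤ 𝔭.asIdeal ∧ exc d k i₀ ∉ 𝔭.asIdeal := by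
  rw [← forall_algebraMap_X_mem_iff i₀ 𝔭.asIdeal, Set.mem_preimage, vertexChart_comp_apply hb i₀ 𝔭, Set.mem_sdiff,
    Set.mem_singleton_iff, mem_vertexLine_iff, eq_vertex_iff]
  simp only [X_castSucc_mem_awayι_iff, chartGen_mem_iff i₀ 𝔭]

/-- Over ANOTHER vertex chart (`i ≠ i₀`) no point lies over the punctured line (there `X_i = 0` forces every `X_j = X_i · X_j/X_i = 0`).
[folklore] -/
theorem vertexChart_apply_notMem_of_ne {i : Fin (d + 1)} (hi : i ≠ i₀) (𝔭 : Spec (.of (Chart d k i))) :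
    vertexChart hb i 𝔭 ∉ b ⁻¹' (vertexLine d k i₀ \ {vertex d k}) := by
  rw [Set.mem_preimage, vertexChart_comp_apply hb i 𝔭, Set.mem_sdiff, Set.mem_singleton_iff, mem_vertexLine_iff, eq_vertex_iff]
  simp only [X_castSucc_mem_awayι_iff, chartGen_mem_iff i 𝔭]
  rintro ⟨hall, hnot⟩
  apply hnot
  have hexc : exc d k i ∈ 𝔭.asIdeal := hall i hi
  intro j
  rw [PointBlowup.algebraMap_X]
  exact Ideal.mul_mem_right _ _ hexc

/-- ★ **The strict transform of the line meets the vertex chart `Spec Cᵢ₀` in `V(X_j/X_{i₀} : j ≠ i₀)`.**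
[cite: Hartshorne1977, II §7 (strict transform)] (OURS computation; folklore) -/
theorem preimage_vertexChart_vertexLineStrict :
    (vertexChart hb i₀) ⁻¹' vertexLineStrict b i₀ =
      PrimeSpectrum.zeroLocus (Ideal.span (frac d k i₀ '' {i₀}ᶜ) : Set (Chart d k i₀)) := by
  rw [preimage_vertexLineStrict_of_isOpenEmbedding b i₀ (vertexChart hb i₀).isOpenEmbedding, ← closure_zeroLocus_inter_eq i₀]
  congr 1
  ext 𝔭
  exact vertexChart_apply_mem_iff hb i₀ 𝔭

/-- The strict transform of the line misses the other vertex charts. [folklore] -/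
theorem preimage_vertexChart_vertexLineStrict_of_ne {i : Fin (d + 1)} (hi : i ≠ i₀) :
    (vertexChart hb i) ⁻¹' vertexLineStrict b i₀ = ∅ := by
  rw [preimage_vertexLineStrict_of_isOpenEmbedding b i₀ (vertexChart hb i).isOpenEmbedding]
  convert closure_empty
  ext 𝔭
  simpa using vertexChart_apply_notMem_of_ne hb i₀ hi 𝔭

end Points

end Summit.ResolutionOfSingularities.ResolutionOfSingularities.Cruxes.EquisingularLiftNat.Sections

end
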